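import Mathlib
import HarnessLib
import Summits.NavierStokesRegularity.NavierStokesRegularity.Theorems.PoloidalWindowDoorLrcModEntireShearedKinematics

/-!
# Route `PoloidalWindowDoor`, item `LrcModEntire` (stmt-NavierStokesRegularity-20428), cell (Q4-sonic, straight branch), case I, PERIODIC branch —
# THE TWO KINEMATIC ROWS FOR THE COMPONENTS OF A FIELD in sheared coordinates (P1 of the LEAD picks 20:4xZ; T2B-g17 v10 §9/§10)

Cell ns-regularity-ideate, LEAD-lineage seat ns-poloidal-K2-p3 g17 (`--supports stmt-NavierStokesRegularity-20428`).  Class-free calculus, the companion of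
ns-k2-port-2 g8's `…ShearedKinematics` (p741673): there the unknowns were the components of `∂_eW`; here they are the components of the field ITSELF,
`(fun q : ℝ × E3 => V q 2) q := V(q)₂`, `(fun q : ℝ × E3 => ⟪e, V q⟫_ℝ) q := ⟪e, V q⟫`, `(fun q : ℝ × E3 => ⟪Jvec e, V q⟫_ℝ) q := ⟪Je, V q⟫` for a space–time field `V : ℝ × ℝ³ → ℝ³` smooth on `T × ℝ³` — in the periodic branch
`V = D := U(·, · + L e) − U` (a difference of class profiles: smooth, poloidal, divergence-free).  With the moving shear `Φ` of `…ShearedCoordinates`: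
* ★ `pd_dN_PF_eq` (POLOIDAL slices, `e` horizontal): `∂_m(P∘Φ) = ∂_s(Q∘Φ)`  (`⟪e, ∂_{Je}V⟫ = ⟪Je, ∂_eV⟫`);
* ★ `pd_dN_QF_eq` (DIVERGENCE-FREE slices, `e` horizontal unit): `∂_m(Q∘Φ) = −∂_s(P∘Φ) − (∂_z′ − d_z∂_m)(g∘Φ)`  (frame trace of `DV` = `div V = 0`);
* `contDiffOn_gF_PF_QF`, `analyticOnNhd_slices_F` (the smoothness / normal-line analyticity inputs of `…SheetSystemMixed.eq_zero_of_mixedSystem_template`).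
These are the rows `hR1`, `hR2` of the template for `(ϑ, P_D, Q_D) := (D₂, ⟪e,D⟫, ⟪Je,D⟫) ∘ Φ`.

WHAT THIS IS NOT: not a claim about Navier–Stokes regularity and not a stub of the registry; class-free calculus for the residual research cell `stub_Q4sonicLineNeg`
of `Cruxes/LrcModEntire/Lines/twist_split.lean` v13 (bears_on LADDER-NS N0 via item 20428).
-/

noncomputable section

set_option linter.dupNamespace false

namespace Summit.NavierStokesRegularity.NavierStokesRegularity.Theorems.PoloidalWindowDoorLrcModEntireShearedKinematicsField

open Set Function Filter Topology Metric InnerProductSpace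
open scoped RealInnerProductSpace InnerProductSpace ContDiff
open Literature.Analysis Literature.Analysis.FluidPDE
open Summit.NavierStokesRegularity.NavierStokesRegularity.Theorems.PoloidalWindowDoorLrcModEntireSheetFlattenTools
open Summit.NavierStokesRegularity.NavierStokesRegularity.Theorems.PoloidalWindowDoorLrcModEntireSheetSystemUniqueness
open Summit.NavierStokesRegularity.NavierStokesRegularity.Theorems.PoloidalWindowDoorLrcModEntireShearedCoordinates
open Summit.NavierStokesRegularity.NavierStokesRegularity.Theorems.PoloidalWindowDoorLrcModEntireShearedKinematics
open Summit.NavierStokesRegularity.NavierStokesRegularity.Theorems.PoloidalWindowDoorPoloidalWindowRigidityAxisymmetric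
open Summit.NavierStokesRegularity.NavierStokesRegularity.Theorems.PoloidalWindowDoorPoloidalWindowRigidityConstantShearSlice

variable {V : ℝ × E3 → E3} {e : E3}
variable {T : Set ℝ} {O : Set Y3} {D : Set (ℝ × ℝ)} {d : ℝ × ℝ → ℝ}

/-- Derivative of `q ↦ ⟪c, V q⟫`. -/
theorem fderiv_inner_field {q : ℝ × E3} (hV : DifferentiableAt ℝ V q) (c : E3) (u : ℝ × E3) :
    fderiv ℝ (fun q' => ⟪c, V q'⟫_ℝ) q u = ⟪c, fderiv ℝ V q u⟫_ℝ := by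
  rw [fderiv_inner_apply ℝ (differentiableAt_const c) hV]
  simp

/-- Derivative of `q ↦ (V q)₂`. -/
theorem fderiv_coord_field {q : ℝ × E3} (hV : DifferentiableAt ℝ V q) (u : ℝ × E3) :
    fderiv ℝ (fun q' => V q' 2) q u = fderiv ℝ V q u 2 := by
  have h := ((EuclideanSpace.proj (𝕜 := ℝ) (2 : Fin 3)).hasFDerivAt.comp q hV.hasFDerivAt).fderiv
  have hfun : (⇑(EuclideanSpace.proj (𝕜 := ℝ) (2 : Fin 3)) ∘ V) = fun q' => V q' 2 := by funext q'; simp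
  rw [hfun] at h
  rw [h]; rfl

/-- The three components are smooth on `T × ℝ³` when `V` is. -/
theorem contDiffOn_gF_PF_QF (hV : ContDiffOn ℝ ∞ V (T ×ˢ (univ : Set E3))) :
    ContDiffOn ℝ ∞ ((fun q : ℝ × E3 => V q 2)) (T ×ˢ (univ : Set E3)) ∧ ContDiffOn ℝ ∞ ((fun q : ℝ × E3 => ⟪e, V q⟫_ℝ)) (T ×ˢ (univ : Set E3)) ∧
      ContDiffOn ℝ ∞ ((fun q : ℝ × E3 => ⟪Jvec e, V q⟫_ℝ)) (T ×ˢ (univ : Set E3)) := by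
  refine ⟨?_, ?_, ?_⟩
  · exact (EuclideanSpace.proj (𝕜 := ℝ) (2 : Fin 3)).contDiff.comp_contDiffOn hV
  · exact (innerSL ℝ e).contDiff.comp_contDiffOn hV
  · exact (innerSL ℝ (Jvec e)).contDiff.comp_contDiffOn hV

/-- Analytic slices of `V` give analytic slices of the three components. -/
theorem analyticOnNhd_slices_F (hVan : ∀ t ∈ T, AnalyticOnNhd ℝ (fun x : E3 => V (t, x)) univ) {t : ℝ} (ht : t ∈ T) :
    AnalyticOnNhd ℝ (fun x : E3 => (fun q : ℝ × E3 => V q 2) (t, x)) univ ∧ AnalyticOnNhd ℝ (fun x : E3 => (fun q : ℝ × E3 => ⟪e, V q⟫_ℝ) (t, x)) univ ∧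
      AnalyticOnNhd ℝ (fun x : E3 => (fun q : ℝ × E3 => ⟪Jvec e, V q⟫_ℝ) (t, x)) univ := by
  refine ⟨fun x _ => ?_, fun x _ => ?_, fun x _ => ?_⟩
  · exact ((EuclideanSpace.proj (𝕜 := ℝ) (2 : Fin 3)).analyticAt _).comp (hVan t ht x (mem_univ _))
  · exact ((innerSL ℝ e).analyticAt _).comp (hVan t ht x (mem_univ _))
  · exact ((innerSL ℝ (Jvec e)).analyticAt _).comp (hVan t ht x (mem_univ _))

/-! ### The two kinematic rows -/

/-- ★ **`∂_m(⟪e,V⟫∘Φ) = ∂_s(⟪Je,V⟫∘Φ)`** on the tube, from POLOIDAL slices (`(curl V(t,·))₂ = 0` for `t ∈ T`), `e` horizontal. -/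
theorem pd_dN_PF_eq (hT : IsOpen T) (hV : ContDiffOn ℝ ∞ V (T ×ˢ (univ : Set E3)))
    (hcurl : ∀ t ∈ T, ∀ x : E3, FluidPDE.curl (fun y : E3 => V (t, y)) x 2 = 0) (he2 : e 2 = 0)
    (hOT : ∀ y ∈ O, y.1 ∈ T) (hD : IsOpen D) (hd : ContDiffOn ℝ ∞ d D) (hOD : ∀ y ∈ O, (y.1, y.2.2) ∈ D) {p : Y3 × ℝ} (hp : p ∈ tube O) :
    pd dN ((fun q : ℝ × E3 => ⟪e, V q⟫_ℝ) ∘ shearMap e d) p = pd (tg eS) ((fun q : ℝ × E3 => ⟪Jvec e, V q⟫_ℝ) ∘ shearMap e d) p := by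
  obtain ⟨-, hPs, hQs⟩ := contDiffOn_gF_PF_QF (e := e) hV
  obtain ⟨hPd, -, hdp⟩ := differentiableAt_data (F := (fun q : ℝ × E3 => ⟪e, V q⟫_ℝ)) hT hPs hOT hD hd hOD hp
  obtain ⟨hQd, -, -⟩ := differentiableAt_data (F := (fun q : ℝ × E3 => ⟪Jvec e, V q⟫_ℝ)) hT hQs hOT hD hd hOD hp
  set q := shearMap e d p with hq_def
  have hq1 : q.1 ∈ T := (shearMap_mem (e := e) (d := d) hOT hp).1
  obtain ⟨-, hVd, -, -⟩ := regular_at hT hV hq1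
  rw [pd_dN_comp_shearMap e d hPd hdp, pd_tgS_comp_shearMap e d hQd hdp]
  rw [fderiv_inner_field hVd, fderiv_inner_field hVd]
  have hJ2 : (Jvec e) 2 = 0 := by simp [Jvec]
  have hVd' : DifferentiableAt ℝ V (q.1, q.2) := hVd
  have h := inner_fderiv_comm_of_curl_two_eq_zero (hcurl q.1 hq1 q.2) (k₁ := e) (k₂ := Jvec e) he2 hJ2
  rw [fderiv_slice_eq hVd' (Jvec e), fderiv_slice_eq hVd' e] at h
  simpa only [Prod.mk.eta, real_inner_comm] using h

/-- ★ **`∂_m(⟪Je,V⟫∘Φ) = −∂_s(⟪e,V⟫∘Φ) − (∂_z′ − d_z∂_m)(V₂∘Φ)`** on the tube, from DIVERGENCE-FREE slices, `e` a horizontal unit vector. -/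
theorem pd_dN_QF_eq (hT : IsOpen T) (hV : ContDiffOn ℝ ∞ V (T ×ˢ (univ : Set E3)))
    (hdiv : ∀ t ∈ T, FluidPDE.VectorCalculus.IsDivFree (fun y : E3 => V (t, y))) (he2 : e 2 = 0) (hunit : e 0 ^ 2 + e 1 ^ 2 = 1)
    (hOT : ∀ y ∈ O, y.1 ∈ T) (hD : IsOpen D) (hd : ContDiffOn ℝ ∞ d D) (hOD : ∀ y ∈ O, (y.1, y.2.2) ∈ D) {p : Y3 × ℝ} (hp : p ∈ tube O) :
    pd dN ((fun q : ℝ × E3 => ⟪Jvec e, V q⟫_ℝ) ∘ shearMap e d) p =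
      -pd (tg eS) ((fun q : ℝ × E3 => ⟪e, V q⟫_ℝ) ∘ shearMap e d) p
        - (pd (tg PoloidalWindowDoorLrcModEntireShearedCoordinates.eZ) ((fun q : ℝ × E3 => V q 2) ∘ shearMap e d) p
            - fderiv ℝ d (p.1.1, p.1.2.2) ((0 : ℝ), (1 : ℝ)) * pd dN ((fun q : ℝ × E3 => V q 2) ∘ shearMap e d) p) := by
  obtain ⟨hgs, hPs, hQs⟩ := contDiffOn_gF_PF_QF (e := e) hV
  obtain ⟨hPd, -, hdp⟩ := differentiableAt_data (F := (fun q : ℝ × E3 => ⟪e, V q⟫_ℝ)) hT hPs hOT hD hd hOD hp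
  obtain ⟨hQd, -, -⟩ := differentiableAt_data (F := (fun q : ℝ × E3 => ⟪Jvec e, V q⟫_ℝ)) hT hQs hOT hD hd hOD hp
  obtain ⟨hgd, -, -⟩ := differentiableAt_data (F := (fun q : ℝ × E3 => V q 2)) hT hgs hOT hD hd hOD hp
  set q := shearMap e d p with hq_def
  have hq1 : q.1 ∈ T := (shearMap_mem (e := e) (d := d) hOT hp).1
  obtain ⟨-, hVd, -, -⟩ := regular_at hT hV hq1
  rw [pd_tgZ_sub_comp_shearMap e d hgd hdp, pd_dN_comp_shearMap e d hQd hdp, pd_tgS_comp_shearMap e d hPd hdp]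
  rw [fderiv_inner_field hVd, fderiv_inner_field hVd, fderiv_coord_field hVd]
  -- the frame trace identity `⟪e, DV[(0,e)]⟫ + ⟪Je, DV[(0,Je)]⟫ + DV[(0,e₂)]₂ = 0` at `q`
  have hVd' : DifferentiableAt ℝ V (q.1, q.2) := hVd
  set B : E3 →L[ℝ] E3 →L[ℝ] ℝ :=
    ((innerSL ℝ (E := E3)).flip).comp ((fderiv ℝ V q).comp (ContinuousLinearMap.inr ℝ ℝ E3)) with hB
  have hBab : ∀ a b : E3, B a b = ⟪b, fderiv ℝ V q ((0 : ℝ), a)⟫_ℝ := fun a b => by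
    first
      | (simp only [hB, ContinuousLinearMap.coe_comp, Function.comp_apply, ContinuousLinearMap.flip_apply, ContinuousLinearMap.inr_apply]; done)
      | (simp only [hB, ContinuousLinearMap.coe_comp, Function.comp_apply, ContinuousLinearMap.flip_apply, ContinuousLinearMap.inr_apply]
         rfl)
  have hfr := bilin_frame_trace B he2 hunit
  rw [hBab, hBab, hBab, hBab] at hfr
  have hc : ∀ i : Fin 3, ⟪EuclideanSpace.single i (1 : ℝ), fderiv ℝ V q ((0 : ℝ), EuclideanSpace.single i (1 : ℝ))⟫_ℝ =
      fderiv ℝ (fun y : E3 => V (q.1, y)) q.2 (EuclideanSpace.single i (1 : ℝ)) i := fun i => by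
    rw [EuclideanSpace.inner_single_left, fderiv_slice_eq hVd']; simp
  rw [hc 0, hc 1] at hfr
  have hdv := div_coord (hdiv q.1 hq1) q.2
  rw [fderiv_slice_eq hVd' (EuclideanSpace.single 2 (1 : ℝ))] at hdv
  rw [show e2 = EuclideanSpace.single 2 (1 : ℝ) from rfl]
  simp only [Prod.mk.eta] at hfr hdv
  linarith

end Summit.NavierStokesRegularity.NavierStokesRegularity.Theorems.PoloidalWindowDoorLrcModEntireShearedKinematicsField

end
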